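import Literature.Analysis.FluidPDE.HomogeneousEuler
import Literature.Analysis.FluidPDE.IsometryInvariance
import HarnessLib

/-!
# Log-periodic (discretely self-similar) stationary Euler cones

A stationary solution `(h, P)` of the incompressible Euler system, understood classically on
`ℝ³ ∖ {0}`,

  `(h · ∇) h + ∇P = 0`, `div h = 0`                                     (Shvydkoy 2018, (1))

is mapped to another one by the two-parameter scaling group of the Euler equations
`v ↦ λ^α v(λ x, λ^{α+1} t)`, `p ↦ λ^{2α} p(λ x, λ^{α+1} t)`, `λ > 0`, `α ∈ ℝ` (Chae–Tsai 2014,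
(1.1); on time-independent fields the time dilation is invisible). A solution is *self-similar*
if it is fixed by this scaling for **every** `λ > 0` and *discretely self-similar (DSS) with
factor `λ`* if it is fixed "for one single `λ > 1`" (Chae–Tsai 2014, (1.2) and the paragraph
after (1.3)). For a stationary pair this reads

  `h(λ x) = λ^{-α} h(x)`, `P(λ x) = λ^{-2α} P(x)`       (`x ≠ 0`).

Asked for every `λ > 0` these are Shvydkoy's **homogeneous** stationary solutions
(`Literature.Analysis.FluidPDE.IsHomogeneousSteadyEuler`, file `HomogeneousEuler.lean`,
Shvydkoy 2018 (2)); asked for one ratio `λ = l₀` they are the **log-periodic cones** of this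
file: writing `x = e^s θ` with `θ ∈ S²`, the field is `h(x) = e^{-a s} H(θ, s)` with `H`
periodic in `s = log |x|` of period `log l₀`, so `(h, P)` descends to the compact quotient
`S² × (ℝ / (log l₀) ℤ)` of `ℝ³ ∖ {0}` by the discrete dilation group `l₀^ℤ` — the stationary
analogue of Chae–Tsai's remark that a DSS solution is a time-periodic solution of the
self-similar Euler system (1.6)–(1.7).

## Contents (all proved)

* `Literature.Analysis.FluidPDE.IsLogPeriodicSteadyEulerCone a l₀ h P` — the predicate: `h`, `P`
  of class `C¹` on `E ∖ {0}`, `h (l₀ • x) = l₀^{-a} • h x` and `P (l₀ • x) = l₀^{-2a} P x` for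
  `x ≠ 0`, `div h = 0` and `(h·∇)h + ∇P = 0` pointwise on `E ∖ {0}` (`E` a finite-dimensional
  real inner product space; the requesting route has `E = ℝ³`). It is **verbatim** the
  conjunction of the six analytic clauses shared by the items `InteractingLogPeriodicCone`,
  `CollapsingResolver`, `SkeletonRealisation` of the route `NavierStokesRegularity/ConeTipCollapse`
  (`isLogPeriodicSteadyEulerCone_iff` restates it in exactly that unbundled form).
* API: the trivial pair (`.zero`); differentiability off the origin; **homogeneous ⇒
  log-periodic of every ratio `l₀ > 0`** (`IsHomogeneousSteadyEuler.isLogPeriodicSteadyEulerCone`)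
  and conversely homogeneity is log-periodicity of every ratio
  (`isHomogeneousSteadyEuler_iff_forall_isLogPeriodicSteadyEulerCone`); the admissible ratios of a
  fixed pair form a subgroup of `(0, ∞)`: ratio `1` is no condition (`.of_ratio_one`,
  `.ratio_one`), products (`.mul`), inverses (`.inv`), powers (`.pow`, `.zpow` — the discrete
  dilation group `l₀^ℤ`); and **covariance under linear isometries** (`.conj`: if `(h, P)` is a
  cone then so is `(R ∘ h ∘ R⁻¹, P ∘ R⁻¹)` for every `R : E ≃ₗᵢ[ℝ] E`, in particular for the 24
  chiral octahedral rotations used by the route), from the pointwise covariance of `div`,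
  `(·∇)·`, `∇` in `IsometryInvariance.lean`.

## Design notes

* The ratio `l₀` and the exponent `a` are free real parameters; the intended regime is
  `1 < l₀` (equivalently, by `.inv`, `0 < l₀ ≠ 1`), which requesters state as a separate
  hypothesis exactly as the route items do (`1 < a ∧ a < 3/2 ∧ 1 < l₀ ∧ …`). For `l₀ = 1` the two
  scaling clauses are vacuous (`.of_ratio_one`); for `l₀ ≤ 0` they involve the junk values of
  `Real.rpow` and the predicate is not meaningful.
* As in `IsHomogeneousSteadyEuler`, everything is asserted only at `x ≠ 0` (the values `h 0`,
  `P 0` are junk), regularity is exactly `C¹` on the open set `{x ≠ 0}` (Shvydkoy's "at least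
  `C¹`", Chae–Tsai's classical solutions), derivatives are Mathlib's `fderiv` / `gradient`, and
  `(h·∇)h = convect h h`, `div h = VectorCalculus.divergence h` are the tree's
  (`VectorCalculus.lean`).
* Not included (not needed by any requester yet): the "interacting" and `O`-equivariance clauses
  of the route items (stated there inline), and the relation with the space–time notion
  `IsDiscretelySelfSimilar` of `SelfSimilar.lean` (Navier–Stokes scaling, i.e. the case `a = 1`
  on time-independent fields).

## Mathlib search

No predicate for homogeneous or discretely self-similar maps between normed spaces (only
`MvPolynomial.IsHomogeneous`, graded homogeneity); the tree's `IsDiscretelySelfSimilar`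
(`SelfSimilar.lean`) is the parabolic space–time notion. Used: `Real.mul_rpow`, `Real.inv_rpow`,
`Real.one_rpow`, `zpow_natCast`, `zpow_negSucc`, `LinearIsometryEquiv.map_smul`,
`ContDiffOn.comp`, and the tree's `divergence_conj_linearIsometryEquiv`,
`convect_conj_linearIsometryEquiv`, `gradient_comp_linearIsometryEquiv_symm`.

## References

* D. Chae, T.-P. Tsai, *On discretely self-similar solutions of the Euler equations*, Math. Res.
  Lett. 21 (2014), no. 3, 437–447, doi:10.4310/mrl.2014.v21.n3.a2 = arXiv:1304.7414; §1,
  (1.1)–(1.2) and the definition of DSS after (1.3). [`ChaeTsai2014`]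
* R. Shvydkoy, *Homogeneous solutions to the 3D Euler system*, Trans. Amer. Math. Soc. 370
  (2018), 2517–2535, doi:10.1090/tran/7022 = arXiv:1510.03378; (1)–(2) p. 2518. [`Shvydkoy2018`]
* A. J. Majda, A. L. Bertozzi, *Vorticity and Incompressible Flow* (CUP 2002), §1.2 Prop. 1.1
  (scaling and rotation symmetries of the Euler equations).
-/

noncomputable section

open Set Filter
open scoped InnerProductSpace RealInnerProductSpace Topology

namespace Literature.Analysis.FluidPDE

variable {E : Type*} [NormedAddCommGroup E] [InnerProductSpace ℝ E] [FiniteDimensional ℝ E]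

/-- **Log-periodic (discretely self-similar) stationary Euler cone** of exponent `a` and ratio
`l₀`: a pair `(h, P)` of class `C¹` on `E ∖ {0}` which is a classical stationary solution of the
incompressible Euler system there, `div h = 0`, `(h·∇)h + ∇P = 0` (Shvydkoy 2018, (1)), and is
fixed by the Euler scaling `(h, P) ↦ (l₀^a h(l₀ ·), l₀^{2a} P(l₀ ·))` for the single factor `l₀`
(Chae–Tsai 2014, (1.1)–(1.2): "discretely self-similar with factor `λ`", here on time-independent
fields): `h (l₀ x) = l₀^{-a} h(x)`, `P (l₀ x) = l₀^{-2a} P(x)` for `x ≠ 0`. Requiring the scaling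
law for every factor `c > 0` instead gives `IsHomogeneousSteadyEuler a h P`
(`isHomogeneousSteadyEuler_iff_forall_isLogPeriodicSteadyEulerCone`). Intended with `1 < l₀`,
stated separately by users; the values `h 0`, `P 0` are junk. [cite: ChaeTsai2014, §1 (1.1)–(1.2)] -/
structure IsLogPeriodicSteadyEulerCone (a l₀ : ℝ) (h : E → E) (P : E → ℝ) : Prop where
  /-- The velocity is `C¹` on `E ∖ {0}`. -/
  contDiffOn_velocity : ContDiffOn ℝ 1 h {x | x ≠ 0}
  /-- The pressure is `C¹` on `E ∖ {0}`. -/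
  contDiffOn_pressure : ContDiffOn ℝ 1 P {x | x ≠ 0}
  /-- Discrete self-similarity of the velocity: `h (l₀ x) = l₀^{-a} h(x)` for `x ≠ 0`. -/
  velocity_smul : ∀ ⦃x : E⦄, x ≠ 0 → h (l₀ • x) = (l₀ ^ (-a)) • h x
  /-- Discrete self-similarity of the pressure: `P (l₀ x) = l₀^{-2a} P(x)` for `x ≠ 0`. -/
  pressure_smul : ∀ ⦃x : E⦄, x ≠ 0 → P (l₀ • x) = l₀ ^ (-(2 * a)) * P x
  /-- Incompressibility `div h = 0` on `E ∖ {0}`. -/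
  divergence_eq_zero : ∀ ⦃x : E⦄, x ≠ 0 → VectorCalculus.divergence h x = 0
  /-- The stationary Euler equation `(h·∇)h + ∇P = 0` on `E ∖ {0}`. -/
  momentum : ∀ ⦃x : E⦄, x ≠ 0 → convect h h x + gradient P x = 0

/-- `IsLogPeriodicSteadyEulerCone a l₀ h P` unbundled: **verbatim** the six analytic clauses of the
items `InteractingLogPeriodicCone` / `CollapsingResolver` / `SkeletonRealisation` of the route
`NavierStokesRegularity/ConeTipCollapse` (there with `E = EuclideanSpace ℝ (Fin 3)`). [folklore] -/
theorem isLogPeriodicSteadyEulerCone_iff {a l₀ : ℝ} {h : E → E} {P : E → ℝ} :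
    IsLogPeriodicSteadyEulerCone a l₀ h P ↔
      ContDiffOn ℝ 1 h {x : E | x ≠ 0} ∧ ContDiffOn ℝ 1 P {x : E | x ≠ 0} ∧
        (∀ x : E, x ≠ 0 → h (l₀ • x) = (l₀ ^ (-a)) • h x) ∧
        (∀ x : E, x ≠ 0 → P (l₀ • x) = l₀ ^ (-(2 * a)) * P x) ∧
        (∀ x : E, x ≠ 0 → VectorCalculus.divergence h x = 0) ∧
        (∀ x : E, x ≠ 0 → convect h h x + gradient P x = 0) :=
  ⟨fun c => ⟨c.contDiffOn_velocity, c.contDiffOn_pressure, c.velocity_smul, c.pressure_smul,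
      c.divergence_eq_zero, c.momentum⟩,
    fun ⟨h₁, h₂, h₃, h₄, h₅, h₆⟩ => ⟨h₁, h₂, @h₃, @h₄, @h₅, @h₆⟩⟩

namespace IsLogPeriodicSteadyEulerCone

variable {a l₀ : ℝ} {h : E → E} {P : E → ℝ}

/-- The trivial pair `(h, P) = (0, 0)` is a log-periodic stationary Euler cone of every exponent
and ratio. [folklore] -/
theorem zero (a l₀ : ℝ) : IsLogPeriodicSteadyEulerCone a l₀ (0 : E → E) (0 : E → ℝ) where
  contDiffOn_velocity := contDiffOn_const
  contDiffOn_pressure := contDiffOn_const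
  velocity_smul x _ := by simp
  pressure_smul x _ := by simp
  divergence_eq_zero x _ := by simp [VectorCalculus.divergence, Pi.zero_def]
  momentum x _ := by simp [convect, Pi.zero_def]

/-- The velocity of a log-periodic cone is differentiable off the origin (`{x ≠ 0}` is open). [folklore] -/
theorem differentiableAt_velocity (hc : IsLogPeriodicSteadyEulerCone a l₀ h P) {x : E}
    (hx : x ≠ 0) : DifferentiableAt ℝ h x :=
  (hc.contDiffOn_velocity.differentiableOn one_ne_zero).differentiableAt (isOpen_ne.mem_nhds hx)

/-- The pressure of a log-periodic cone is differentiable off the origin. [folklore] -/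
theorem differentiableAt_pressure (hc : IsLogPeriodicSteadyEulerCone a l₀ h P) {x : E}
    (hx : x ≠ 0) : DifferentiableAt ℝ P x :=
  (hc.contDiffOn_pressure.differentiableOn one_ne_zero).differentiableAt (isOpen_ne.mem_nhds hx)

/-! ### The group of ratios -/

/-- **Ratio `1` is no condition**: every `C¹` stationary Euler pair on `E ∖ {0}` is a
log-periodic cone of ratio `1` and any exponent (so users must ask `1 < l₀` separately). [folklore] -/
theorem of_ratio_one (hh : ContDiffOn ℝ 1 h {x | x ≠ 0}) (hP : ContDiffOn ℝ 1 P {x | x ≠ 0})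
    (hdiv : ∀ ⦃x : E⦄, x ≠ 0 → VectorCalculus.divergence h x = 0)
    (hmom : ∀ ⦃x : E⦄, x ≠ 0 → convect h h x + gradient P x = 0) (a : ℝ) :
    IsLogPeriodicSteadyEulerCone a 1 h P where
  contDiffOn_velocity := hh
  contDiffOn_pressure := hP
  velocity_smul x _ := by rw [one_smul, Real.one_rpow, one_smul]
  pressure_smul x _ := by rw [one_smul, Real.one_rpow, one_mul]
  divergence_eq_zero := hdiv
  momentum := hmom

/-- A log-periodic cone of some ratio is one of ratio `1` and every exponent. [folklore] -/
theorem ratio_one (hc : IsLogPeriodicSteadyEulerCone a l₀ h P) (b : ℝ) :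
    IsLogPeriodicSteadyEulerCone b 1 h P :=
  of_ratio_one hc.contDiffOn_velocity hc.contDiffOn_pressure hc.divergence_eq_zero hc.momentum b

/-- **Products of ratios**: if `(h, P)` is log-periodic of ratios `l₀ ≥ 0` and `l₁ > 0` (same
exponent), it is log-periodic of ratio `l₀ l₁`:
`h (l₀ l₁ x) = l₀^{-a} h (l₁ x) = (l₀ l₁)^{-a} h x`. [folklore] -/
theorem mul {l₁ : ℝ} (h₀ : IsLogPeriodicSteadyEulerCone a l₀ h P)
    (h₁ : IsLogPeriodicSteadyEulerCone a l₁ h P) (hl₀ : 0 ≤ l₀) (hl₁ : 0 < l₁) :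
    IsLogPeriodicSteadyEulerCone a (l₀ * l₁) h P where
  contDiffOn_velocity := h₀.contDiffOn_velocity
  contDiffOn_pressure := h₀.contDiffOn_pressure
  velocity_smul x hx := by
    have hx₁ : l₁ • x ≠ 0 := smul_ne_zero hl₁.ne' hx
    rw [mul_smul, h₀.velocity_smul hx₁, h₁.velocity_smul hx, smul_smul, ← Real.mul_rpow hl₀ hl₁.le]
  pressure_smul x hx := by
    have hx₁ : l₁ • x ≠ 0 := smul_ne_zero hl₁.ne' hx
    rw [mul_smul, h₀.pressure_smul hx₁, h₁.pressure_smul hx, ← mul_assoc,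
      ← Real.mul_rpow hl₀ hl₁.le]
  divergence_eq_zero := h₀.divergence_eq_zero
  momentum := h₀.momentum

/-- **Inverse ratio**: a log-periodic cone of ratio `l₀ > 0` is one of ratio `l₀⁻¹`
(`h (l₀⁻¹ x) = l₀^{a} h x`); in particular the regimes `1 < l₀` and `0 < l₀ < 1` are
equivalent. [folklore] -/
theorem inv (hc : IsLogPeriodicSteadyEulerCone a l₀ h P) (hl : 0 < l₀) :
    IsLogPeriodicSteadyEulerCone a l₀⁻¹ h P where
  contDiffOn_velocity := hc.contDiffOn_velocity
  contDiffOn_pressure := hc.contDiffOn_pressure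
  velocity_smul x hx := by
    have hy : l₀⁻¹ • x ≠ 0 := smul_ne_zero (inv_ne_zero hl.ne') hx
    have key := hc.velocity_smul hy
    rw [smul_smul, mul_inv_cancel₀ hl.ne', one_smul] at key
    rw [Real.inv_rpow hl.le, key, smul_smul, inv_mul_cancel₀ (Real.rpow_pos_of_pos hl _).ne',
      one_smul]
  pressure_smul x hx := by
    have hy : l₀⁻¹ • x ≠ 0 := smul_ne_zero (inv_ne_zero hl.ne') hx
    have key := hc.pressure_smul hy
    rw [smul_smul, mul_inv_cancel₀ hl.ne', one_smul] at key
    rw [Real.inv_rpow hl.le, key, ← mul_assoc, inv_mul_cancel₀ (Real.rpow_pos_of_pos hl _).ne',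
      one_mul]
  divergence_eq_zero := hc.divergence_eq_zero
  momentum := hc.momentum

/-- **Natural powers of the ratio**: `h (l₀ⁿ x) = (l₀ⁿ)^{-a} h x`, `P (l₀ⁿ x) = (l₀ⁿ)^{-2a} P x`
for `x ≠ 0`, `n : ℕ` (`l₀ > 0`). [folklore] -/
theorem pow (hc : IsLogPeriodicSteadyEulerCone a l₀ h P) (hl : 0 < l₀) (n : ℕ) :
    IsLogPeriodicSteadyEulerCone a (l₀ ^ n) h P := by
  induction n with
  | zero => rw [pow_zero]; exact hc.ratio_one a
  | succ n ih => rw [pow_succ]; exact ih.mul hc (pow_nonneg hl.le n) hl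

/-- **The discrete dilation group `l₀^ℤ`**: a log-periodic cone of ratio `l₀ > 0` is fixed by
the Euler scaling of every factor `l₀ⁿ`, `n ∈ ℤ`: `h (l₀ⁿ x) = (l₀ⁿ)^{-a} h x`,
`P (l₀ⁿ x) = (l₀ⁿ)^{-2a} P x` for `x ≠ 0` (Chae–Tsai 2014, §1: DSS with factor `λ` is DSS with
every factor `λⁿ`). [folklore] -/
theorem zpow (hc : IsLogPeriodicSteadyEulerCone a l₀ h P) (hl : 0 < l₀) (n : ℤ) :
    IsLogPeriodicSteadyEulerCone a (l₀ ^ n) h P := by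
  cases n with
  | ofNat n => rw [Int.ofNat_eq_natCast, zpow_natCast]; exact hc.pow hl n
  | negSucc n => rw [zpow_negSucc]; exact (hc.pow hl (n + 1)).inv (pow_pos hl _)

/-! ### Covariance under linear isometries -/

omit [FiniteDimensional ℝ E] in
/-- A linear isometry fixes the origin, so its inverse maps `E ∖ {0}` to itself. [folklore] -/
theorem symm_apply_ne_zero (R : E ≃ₗᵢ[ℝ] E) {x : E} (hx : x ≠ 0) : R.symm x ≠ 0 :=
  fun h0 => hx (by simpa using congrArg R h0)

/-- **Conjugation by a linear isometry** (rotation / reflection covariance of the stationary Euler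
system, Majda–Bertozzi Prop. 1.1 (iii), and of the scaling law, which commutes with linear maps):
if `(h, P)` is a log-periodic stationary Euler cone then so is `(R ∘ h ∘ R⁻¹, P ∘ R⁻¹)` for every
linear isometry `R` of `E`, with the same exponent and ratio. For the route
`NavierStokesRegularity/ConeTipCollapse` the relevant `R` are the 24 chiral octahedral rotations
(`IsOctahedralIsometry g ∧ det g = 1`), under which its cones are required to be *invariant*. [folklore] -/
theorem conj (hc : IsLogPeriodicSteadyEulerCone a l₀ h P) (R : E ≃ₗᵢ[ℝ] E) :
    IsLogPeriodicSteadyEulerCone a l₀ (fun x => R (h (R.symm x))) (fun x => P (R.symm x)) where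
  contDiffOn_velocity :=
    R.contDiff.comp_contDiffOn
      (hc.contDiffOn_velocity.comp R.symm.contDiff.contDiffOn
        fun _ hx => symm_apply_ne_zero R hx)
  contDiffOn_pressure :=
    hc.contDiffOn_pressure.comp R.symm.contDiff.contDiffOn fun _ hx => symm_apply_ne_zero R hx
  velocity_smul x hx := by
    rw [R.symm.map_smul, hc.velocity_smul (symm_apply_ne_zero R hx), R.map_smul]
  pressure_smul x hx := by
    rw [R.symm.map_smul, hc.pressure_smul (symm_apply_ne_zero R hx)]
  divergence_eq_zero x hx := by
    rw [divergence_conj_linearIsometryEquiv, hc.divergence_eq_zero (symm_apply_ne_zero R hx)]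
  momentum x hx := by
    rw [convect_conj_linearIsometryEquiv, gradient_comp_linearIsometryEquiv_symm, ← map_add,
      hc.momentum (symm_apply_ne_zero R hx), map_zero]

end IsLogPeriodicSteadyEulerCone

/-! ### Homogeneous solutions are the log-periodic cones of every ratio -/

/-- **Homogeneous ⇒ log-periodic of every ratio**: a homogeneous stationary Euler pair of degree
`-α` (Shvydkoy 2018, (1)–(2): the scaling law for *all* factors `c > 0`) is a log-periodic cone
of exponent `α` and every ratio `l₀ > 0`, in particular every `l₀ > 1` (Chae–Tsai 2014, §1:
"a self-similar solution is considered as a special case" of a DSS one). [folklore] -/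
theorem IsHomogeneousSteadyEuler.isLogPeriodicSteadyEulerCone {α : ℝ} {V : E → E} {P : E → ℝ}
    (hV : IsHomogeneousSteadyEuler α V P) {l₀ : ℝ} (hl : 0 < l₀) :
    IsLogPeriodicSteadyEulerCone α l₀ V P where
  contDiffOn_velocity := hV.contDiffOn_velocity
  contDiffOn_pressure := hV.contDiffOn_pressure
  velocity_smul _ hx := hV.velocity_smul hl hx
  pressure_smul _ hx := hV.pressure_smul hl hx
  divergence_eq_zero := hV.divergence_eq_zero
  momentum := hV.momentum

/-- **Homogeneity is log-periodicity of every ratio**: `IsHomogeneousSteadyEuler α V P` holds iff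
`(V, P)` is a log-periodic stationary Euler cone of exponent `α` and every ratio `l₀ > 0`
(continuous versus discrete dilation invariance; Chae–Tsai 2014, (1.2) "for all `λ > 0`" versus
"for one single `λ`"). [folklore] -/
theorem isHomogeneousSteadyEuler_iff_forall_isLogPeriodicSteadyEulerCone {α : ℝ} {V : E → E}
    {P : E → ℝ} :
    IsHomogeneousSteadyEuler α V P ↔ ∀ ⦃l₀ : ℝ⦄, 0 < l₀ → IsLogPeriodicSteadyEulerCone α l₀ V P := by
  refine ⟨fun hV l₀ hl => hV.isLogPeriodicSteadyEulerCone hl, fun H => ?_⟩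
  have h1 := H one_pos
  exact
    { contDiffOn_velocity := h1.contDiffOn_velocity
      contDiffOn_pressure := h1.contDiffOn_pressure
      velocity_smul := fun c hc x hx => (H hc).velocity_smul hx
      pressure_smul := fun c hc x hx => (H hc).pressure_smul hx
      divergence_eq_zero := h1.divergence_eq_zero
      momentum := h1.momentum }

end Literature.Analysis.FluidPDE
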